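import Summits.KontsevichZagierPeriods.KontsevichZagierPeriods.Theorems.TerasomaMultiplicationTriplicationFromMultiplicationDirichlet

/-!
# `TriplicationFromMultiplication` (stmt-KontsevichZagierPeriods-13693) — part 2: symmetries of
the simplex representation and Dirichlet re-association

Helper file (sequel of `…TriplicationFromMultiplicationDirichlet`). The simplex representation
`Δ(a,b,c) = [{u,v>0,u+v<1}, u^{a-1}v^{b-1}(1-u-v)^{c-1}]` is symmetric in `(a,b,c)` modulo the
moves: `(u,v) ↦ (v,u)` is a coordinate relabelling (`KZ.of_sub_of_reindex_mem_relations`) and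
`(u,v) ↦ (u, 1−u−v)` an affine involution of the simplex with `|det| = 1` (one rule-2 move).
Combined with Dirichlet's move `[β(a,b)] × [β(a+b,c)] ∼ [Δ(a,b,c)]` this gives the three
RE-ASSOCIATION equivalences of products of Beta representations used by the cancellation glue:
`[β(a,b)]×[β(a+b,c)] ∼ [β(b,c)]×[β(b+c,a)] ∼ [β(a,c)]×[β(a+c,b)] ∼ [β(c,a)]×[β(c+a,b)]`
(value shadow: all equal `Γ(a)Γ(b)Γ(c)/Γ(a+b+c)`), and the reflection `[β(a,b)] ∼ [β(b,a)]`.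
-/

noncomputable section

open MeasureTheory Set
open scoped BigOperators

namespace Summit.KontsevichZagierPeriods.TerasomaMultiplication.TriplicationGlue

open Literature.NumberTheory.Transcendental
open Literature.NumberTheory.Transcendental.KZ
open Literature.ModelTheory.ExponentialFields (IsSemialgebraic)
open MvPolynomial (aeval X C)
open Summit.KontsevichZagierPeriods.KontsevichZagierPeriods.BetaCancellationNegative
  (betaKernel betaKernel_one_sub)

/-- The Beta family `(X₀, 1 − X₀)` on `ℝ¹` (local notation `bF`). -/
local notation "bF" => (![MvPolynomial.X 0, 1 - MvPolynomial.X 0] : Fin 2 → MvPolynomial (Fin 1) ℚ)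

/-- The simplex family `(X₀, X₁, 1 − X₀ − X₁)` on `ℝ²` (local notation `sF`). -/
local notation "sF" => (![MvPolynomial.X 0, MvPolynomial.X 1, 1 - MvPolynomial.X 0 - MvPolynomial.X 1] :
  Fin 3 → MvPolynomial (Fin 2) ℚ)

/-- The Beta representation `β(a,b)` (local notation; `h` is the convergence proof). -/
local notation "𝛃(" a ", " b ", " h ")" =>
  IntegralRep.ofMellin (![MvPolynomial.X 0, 1 - MvPolynomial.X 0] : Fin 2 → MvPolynomial (Fin 1) ℚ)
    ![a - 1, b - 1] 1 h

/-- The simplex representation `Δ(a,b,c)` (local notation; `h` is the convergence proof). -/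
local notation "𝚫(" a ", " b ", " c ", " h ")" =>
  IntegralRep.ofMellin (![MvPolynomial.X 0, MvPolynomial.X 1, 1 - MvPolynomial.X 0 - MvPolynomial.X 1] :
    Fin 3 → MvPolynomial (Fin 2) ℚ) ![a - 1, b - 1, c - 1] 1 h

/-! ## Reflection of a Beta representation -/

/-- **`[β(a,b)] ∼ [β(b,a)]`**: one rule-2 move `t ↦ 1 − t` (`KZ.boxReflection 0`). [folklore] -/
theorem beta_symm {a b : ℚ}
    (h : IntegrableOn (mellinIntegrand bF ![a - 1, b - 1] 1) (mellinBox bF) volume)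
    (h' : IntegrableOn (mellinIntegrand bF ![b - 1, a - 1] 1) (mellinBox bF) volume) :
    Equivalent (𝛃(a, b, h)) (𝛃(b, a, h')) := by
  refine of_sub_of_mem_relations_of_boxReflection (0 : Fin 1) ?_ fun x _ => ?_
  · ext x
    simp only [IntegralRep.ofMellin_domain, mem_preimage, mem_mellinBox_bF, boxReflection_apply_self,
      mem_Ioo]
    constructor <;> rintro ⟨h1, h2⟩ <;> constructor <;> linarith
  · simp only [IntegralRep.ofMellin_integrand, mellinIntegrand_bF, boxReflection_apply_self]
    exact (betaKernel_one_sub b a (x 0)).symm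

/-! ## Symmetries of the simplex representation -/

/-- **`[Δ(a,b,c)] ∼ [Δ(b,a,c)]`**: the coordinate swap `(u,v) ↦ (v,u)` (a relabelling move,
`KZ.of_sub_of_reindex_mem_relations`, then congruence of integrands on the domain). [folklore] -/
theorem simplex_swap12 {a b c : ℚ}
    (h : IntegrableOn (mellinIntegrand sF ![a - 1, b - 1, c - 1] 1) (mellinBox sF) volume)
    (h' : IntegrableOn (mellinIntegrand sF ![b - 1, a - 1, c - 1] 1) (mellinBox sF) volume) :
    Equivalent (𝚫(a, b, c, h)) (𝚫(b, a, c, h')) := by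
  have h1 := of_sub_of_reindex_mem_relations (𝚫(a, b, c, h)) (Equiv.swap (0 : Fin 2) 1)
  have h2 : of ((𝚫(a, b, c, h)).reindex (Equiv.swap (0 : Fin 2) 1)) - of (𝚫(b, a, c, h')) ∈ relations := by
    refine of_sub_of_mem_relations_of_eqOn ?_ fun w _ => ?_
    · ext w
      simp only [IntegralRep.reindex_domain, IntegralRep.ofMellin_domain, mem_setOf_eq, mem_mellinBox_sF,
        Equiv.swap_apply_left, Equiv.swap_apply_right]
      constructor <;> rintro ⟨h0, h1, h2⟩ <;> exact ⟨h1, h0, by linarith⟩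
    · simp only [IntegralRep.reindex_integrand, IntegralRep.ofMellin_integrand, mellinIntegrand_sF,
        Equiv.swap_apply_left, Equiv.swap_apply_right]
      rw [show (1:ℝ) - w 1 - w 0 = 1 - w 0 - w 1 by ring]
      ring
  have h3 := relations.add_mem h1 h2
  rwa [sub_add_sub_cancel] at h3

/-- The affine involution `(u,v) ↦ (u, 1−u−v)` of `ℝ²` as a polynomial substitution. [folklore] -/
theorem simplexFlip_apply (z : Fin 2 → ℝ) :
    (fun i => aeval z ((![X 0, 1 - X 0 - X 1] : Fin 2 → MvPolynomial (Fin 2) ℚ) i)) =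
      ![z 0, 1 - z 0 - z 1] := by
  funext i
  fin_cases i <;> simp

/-- The derivative of `(u,v) ↦ (u, 1−u−v)`: the linear map `[[1,0],[−1,−1]]`, determinant `−1`.
[folklore] -/
theorem det_simplexFlipJac :
    (LinearMap.toContinuousLinearMap
      (Matrix.toLin' (!![(1:ℝ), 0; -1, -1] : Matrix (Fin 2) (Fin 2) ℝ))).det = -1 := by
  rw [ContinuousLinearMap.det, LinearMap.coe_toContinuousLinearMap, LinearMap.det_toLin',
    Matrix.det_fin_two_of]
  ring

/-- The derivative applied to a vector. [folklore] -/
theorem simplexFlipJac_apply (v : Fin 2 → ℝ) :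
    (LinearMap.toContinuousLinearMap
      (Matrix.toLin' (!![(1:ℝ), 0; -1, -1] : Matrix (Fin 2) (Fin 2) ℝ))) v = ![v 0, -(v 0) - v 1] := by
  rw [LinearMap.coe_toContinuousLinearMap', Matrix.toLin'_apply]
  funext i
  fin_cases i
  · simp [Matrix.mulVec, dotProduct, Fin.sum_univ_two]
  · simp [Matrix.mulVec, dotProduct, Fin.sum_univ_two]
    ring

/-- `(u,v) ↦ (u, 1−u−v)` is differentiable with the stated (constant) derivative. [folklore] -/
theorem hasFDerivAt_simplexFlip (z : Fin 2 → ℝ) :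
    HasFDerivAt (fun w : Fin 2 → ℝ => (![w 0, 1 - w 0 - w 1] : Fin 2 → ℝ))
      (LinearMap.toContinuousLinearMap
        (Matrix.toLin' (!![(1:ℝ), 0; -1, -1] : Matrix (Fin 2) (Fin 2) ℝ))) z := by
  have h0 : HasFDerivAt (fun y : Fin 2 → ℝ => y 0)
      (ContinuousLinearMap.proj (R := ℝ) (φ := fun _ : Fin 2 => ℝ) 0) z :=
    hasFDerivAt_apply 0 z
  have h1 : HasFDerivAt (fun y : Fin 2 → ℝ => y 1)
      (ContinuousLinearMap.proj (R := ℝ) (φ := fun _ : Fin 2 => ℝ) 1) z :=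
    hasFDerivAt_apply 1 z
  rw [hasFDerivAt_pi']
  refine Fin.forall_fin_two.mpr ⟨?_, ?_⟩
  · have hf : (fun w : Fin 2 → ℝ => (![w 0, 1 - w 0 - w 1] : Fin 2 → ℝ) 0) = fun w => w 0 :=
      funext fun w => rfl
    rw [hf]
    refine h0.congr_fderiv (ContinuousLinearMap.ext fun v => ?_)
    rw [ContinuousLinearMap.coe_comp, Function.comp_apply, simplexFlipJac_apply]
    simp only [ContinuousLinearMap.proj_apply, Matrix.cons_val_zero]
  · have hf : (fun w : Fin 2 → ℝ => (![w 0, 1 - w 0 - w 1] : Fin 2 → ℝ) 1) = fun w => 1 - w 0 - w 1 :=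
      funext fun w => rfl
    rw [hf]
    refine ((h0.const_sub 1).sub h1).congr_fderiv (ContinuousLinearMap.ext fun v => ?_)
    rw [ContinuousLinearMap.coe_comp, Function.comp_apply, simplexFlipJac_apply]
    simp only [sub_apply, neg_apply, ContinuousLinearMap.proj_apply, Matrix.cons_val_zero, Matrix.cons_val_one]

/-- `(u,v) ↦ (u, 1−u−v)` is injective. [folklore] -/
theorem injective_simplexFlip :
    Function.Injective (fun w : Fin 2 → ℝ => (![w 0, 1 - w 0 - w 1] : Fin 2 → ℝ)) := by
  intro z w hzw
  have h0 := congrFun hzw 0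
  have h1 := congrFun hzw 1
  simp only [Matrix.cons_val_zero, Matrix.cons_val_one] at h0 h1
  funext i
  fin_cases i
  · exact h0
  · change z 1 = w 1
    linarith

/-- `(u,v) ↦ (u, 1−u−v)` maps the open simplex ONTO itself (it is an involution). [folklore] -/
theorem image_simplexFlip :
    (fun w : Fin 2 → ℝ => (![w 0, 1 - w 0 - w 1] : Fin 2 → ℝ)) '' mellinBox sF = mellinBox sF := by
  ext u
  simp only [mem_image, mem_mellinBox_sF]
  constructor
  · rintro ⟨z, ⟨h0, h1, h2⟩, rfl⟩
    simp only [Matrix.cons_val_zero, Matrix.cons_val_one]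
    exact ⟨h0, by linarith, by linarith⟩
  · rintro ⟨h0, h1, h2⟩
    refine ⟨![u 0, 1 - u 0 - u 1], ⟨by simpa using h0, by simp; linarith, by simp; linarith⟩, ?_⟩
    funext i
    fin_cases i
    · simp
    · simp only [Matrix.cons_val_zero, Matrix.cons_val_one, Fin.mk_one]
      ring

/-- **`[Δ(a,b,c)] ∼ [Δ(a,c,b)]`**: ONE change-of-variables move along the affine involution
`(u,v) ↦ (u, 1−u−v)` of the simplex (`|det| = 1`). [cite: KontsevichZagier2001, §1.2 rule (2)] -/
theorem simplex_swap23 {a b c : ℚ}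
    (h : IntegrableOn (mellinIntegrand sF ![a - 1, b - 1, c - 1] 1) (mellinBox sF) volume)
    (h' : IntegrableOn (mellinIntegrand sF ![a - 1, c - 1, b - 1] 1) (mellinBox sF) volume) :
    Equivalent (𝚫(a, b, c, h)) (𝚫(a, c, b, h')) := by
  refine changeOfVariablesRel_subset_relations ⟨2, 𝚫(a, b, c, h), 𝚫(a, c, b, h'),
    fun w => ![w 0, 1 - w 0 - w 1],
    fun _ => LinearMap.toContinuousLinearMap (Matrix.toLin' (!![(1:ℝ), 0; -1, -1] : Matrix (Fin 2) (Fin 2) ℝ)),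
    ?_, fun x _ => (hasFDerivAt_simplexFlip x).hasFDerivWithinAt, injective_simplexFlip.injOn, ?_, ?_, rfl⟩
  · exact (isSemialgebraicMapOn_aeval (IntegralRep.isSemialgebraic_domain _)
      (![X 0, 1 - X 0 - X 1] : Fin 2 → MvPolynomial (Fin 2) ℚ)).congr fun z _ => simplexFlip_apply z
  · rw [IntegralRep.ofMellin_domain, IntegralRep.ofMellin_domain, image_simplexFlip]
  · intro z hz
    rw [IntegralRep.ofMellin_domain, mem_mellinBox_sF] at hz
    rw [IntegralRep.ofMellin_integrand, IntegralRep.ofMellin_integrand, mellinIntegrand_sF, mellinIntegrand_sF,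
      det_simplexFlipJac, abs_neg, abs_one, mul_one]
    simp only [Matrix.cons_val_zero, Matrix.cons_val_one]
    rw [show (1:ℝ) - z 0 - (1 - z 0 - z 1) = z 1 by ring]
    ring

/-! ## Re-association of products of Beta representations -/

/-- **Re-association, cyclic form**: `[β(a,b)] × [β(a+b,c)] ∼ [β(b,c)] × [β(b+c,a)]`
(Dirichlet, swap of `u,v`, flip `v ↔ 1−u−v`, Dirichlet backwards). [folklore] -/
theorem reassoc {a b c d e : ℚ} (ha : 0 < a) (hb : 0 < b) (hc : 0 < c) (hd : d = a + b) (he : e = b + c)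
    (h₁ : IntegrableOn (mellinIntegrand bF ![a - 1, b - 1] 1) (mellinBox bF) volume)
    (h₂ : IntegrableOn (mellinIntegrand bF ![d - 1, c - 1] 1) (mellinBox bF) volume)
    (h₃ : IntegrableOn (mellinIntegrand bF ![b - 1, c - 1] 1) (mellinBox bF) volume)
    (h₄ : IntegrableOn (mellinIntegrand bF ![e - 1, a - 1] 1) (mellinBox bF) volume) :
    Equivalent ((𝛃(a, b, h₁)).prod (𝛃(d, c, h₂))) ((𝛃(b, c, h₃)).prod (𝛃(e, a, h₄))) :=
  (((dirichlet hd h₁ h₂ (integrableOn_simplex ha hb hc)).trans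
    (simplex_swap12 (integrableOn_simplex ha hb hc) (integrableOn_simplex hb ha hc))).trans
    (simplex_swap23 (integrableOn_simplex hb ha hc) (integrableOn_simplex hb hc ha))).trans
    (dirichlet he h₃ h₄ (integrableOn_simplex hb hc ha)).symm

/-- **Re-association, transposed form**: `[β(a,b)] × [β(a+b,c)] ∼ [β(a,c)] × [β(a+c,b)]`
(Dirichlet, flip `v ↔ 1−u−v`, Dirichlet backwards). [folklore] -/
theorem reassoc' {a b c d e : ℚ} (ha : 0 < a) (hb : 0 < b) (hc : 0 < c) (hd : d = a + b) (he : e = a + c)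
    (h₁ : IntegrableOn (mellinIntegrand bF ![a - 1, b - 1] 1) (mellinBox bF) volume)
    (h₂ : IntegrableOn (mellinIntegrand bF ![d - 1, c - 1] 1) (mellinBox bF) volume)
    (h₃ : IntegrableOn (mellinIntegrand bF ![a - 1, c - 1] 1) (mellinBox bF) volume)
    (h₄ : IntegrableOn (mellinIntegrand bF ![e - 1, b - 1] 1) (mellinBox bF) volume) :
    Equivalent ((𝛃(a, b, h₁)).prod (𝛃(d, c, h₂))) ((𝛃(a, c, h₃)).prod (𝛃(e, b, h₄))) :=
  ((dirichlet hd h₁ h₂ (integrableOn_simplex ha hb hc)).trans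
    (simplex_swap23 (integrableOn_simplex ha hb hc) (integrableOn_simplex ha hc hb))).trans
    (dirichlet he h₃ h₄ (integrableOn_simplex ha hc hb)).symm

/-- **Re-association, anticyclic form**: `[β(a,b)] × [β(a+b,c)] ∼ [β(c,a)] × [β(c+a,b)]`
(Dirichlet, flip, swap, Dirichlet backwards). [folklore] -/
theorem reassoc2 {a b c d e : ℚ} (ha : 0 < a) (hb : 0 < b) (hc : 0 < c) (hd : d = a + b) (he : e = c + a)
    (h₁ : IntegrableOn (mellinIntegrand bF ![a - 1, b - 1] 1) (mellinBox bF) volume)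
    (h₂ : IntegrableOn (mellinIntegrand bF ![d - 1, c - 1] 1) (mellinBox bF) volume)
    (h₃ : IntegrableOn (mellinIntegrand bF ![c - 1, a - 1] 1) (mellinBox bF) volume)
    (h₄ : IntegrableOn (mellinIntegrand bF ![e - 1, b - 1] 1) (mellinBox bF) volume) :
    Equivalent ((𝛃(a, b, h₁)).prod (𝛃(d, c, h₂))) ((𝛃(c, a, h₃)).prod (𝛃(e, b, h₄))) :=
  (((dirichlet hd h₁ h₂ (integrableOn_simplex ha hb hc)).trans
    (simplex_swap23 (integrableOn_simplex ha hb hc) (integrableOn_simplex ha hc hb))).trans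
    (simplex_swap12 (integrableOn_simplex ha hc hb) (integrableOn_simplex hc ha hb))).trans
    (dirichlet he h₃ h₄ (integrableOn_simplex hc ha hb)).symm

end Summit.KontsevichZagierPeriods.TerasomaMultiplication.TriplicationGlue
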